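import Summits.RiemannHypothesis.RiemannHypothesis.Theorems.TiltedLandingLaw421R3Lens1ArcSignQ

/-!
# TiltedLandingLaw421R3 — lens-1 (part R): the POINT CERTIFICATE — a path-free dual of the nodal link

LENS-1 gen-8 module image `rh33346-cover/lens-1/PointCert-v1.lean` (landing target `…/Theorems/TiltedLandingLaw421R3Lens1ArcSignR.lean`; ONE import =
part Q `…R3Lens1ArcSignQ`; namespace `RhW08.Lens1ArcSign`; 0 `sorry`; checked BY CHAIN over the tree part M with N, P, Q inlined).

THE MECHANISM (new, PATH-FREE).  Let `G = f^{(j)}` be real entire of order `< 2`, `φ = G′/G`, `φ₂ = G″/G′ = φ′/φ + φ`.  Part Q proved JENSEN CONTAINMENT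
for `G`: an upper point of the closed positive face `{Im φ ≥ 0}` lies in the closed Jensen disc of a non-real ZERO.  Apply the same theorem ONE LEVEL UP,
to `G′` (also real entire of order `< 2`): an upper point `z` with `Im φ₂(z) ≥ 0` lies in the closed Jensen disc of a non-real CHILD `w` (`G′ w = 0`,
`‖z − Re w‖ ≤ |Im w|`; `exists_childDisc_of_im_nonneg`) — a CHILD PRODUCER that needs no path, no nodal domain and no count.  Where is that child?
By Jensenʼs theorem (containment for `G` at `w`, where `φ(w) = 0`: `child_mem_jensenDisc`) `w` lies in the closed disc of some non-real zero `r`, and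
CAPTURE GEOMETRY decides: `r ∈ {a, ā}` ⇒ `w` in aʼs disc; `r` NESTED in aʼs disc (`|Re r − Re a| + |Im r| ≤ Im a`) ⇒ `w` in aʼs disc
(`nestedStep_of_mem_nestedDisc`); `r` INVISIBLE from `z` (`2·Im r² < (Re z − Re r)² + 2·Im z²`) ⇒ `r` cannot hold a child whose disc contains `z`
(`not_capture_of_invisible`, the √2-lemma).  Hence ★★ `exists_nestedChild_of_pointCert`: a point `z` of the upper half-plane with `Im(G″/G′)(z) ≥ 0` that
is CERT-CLEAR for `a` (`CertClear f j a z`: every non-real zero is `a, ā`, nested in aʼs disc, or invisible from `z`) produces a non-real child `w` with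
`NestedStep a w` — the first disjunct of `TopPinning` — outright.  ★ `PointCertLawQ` (OPEN, typed, binders of `TopLinkLawQ`): such a point exists for
every simple crossing top; `topPinningCrossing_of_pointCertLaw`, ★★ `topPinning_of_pointCertLaw : PointCertLawQ → TopPinning` (no residual, no class).
§4 THE CENSUS CURRENCY (tilt-free margin).  In C6ʼs model `G = P·e^{gz}` one has `φ = ψ + g` (`ψ = P′/P`, `g ∈ ℝ` the unknown far field) and
`φ₂ = ψ′/(ψ + g) + ψ + g`; ★ `im_div_add_real_ge`: for `Im B > 0` and every real `g`, `Im(A/(B + g)) ≥ −(Re A + ‖A‖)/(2·Im B)` (exact infimum over the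
Möbius circle), so ★ `im_phi2_ge_tiltMargin`: `Im(ψ′/(ψ+g) + ψ + g) ≥ tiltMargin ψ ψ′ := Im ψ − (Re ψ′ + ‖ψ′‖)/(2·Im ψ)` for EVERY tilt.  A bank row is
settled path-free, for all tilts at once, by ONE point `z ∈ D_a` with `tiltMargin (ψ z) (ψ′ z) ≥ 0` and `CertClear` (exact rational checks).  Toy
(`linktoy/certscan.py`): such a point exists in 40/60 atomic-type, 26/60 N2, 8/40 N3, 13/40 toothed random frames — a PARTIAL mechanism (it covers
«high» mates; the certificate blob sits just below the mate, between it and aʼs vertical), complementary to the link; where it exists it is a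
finite inequality, not a topology.  `deriv2_div_eq_phi2` records `G″/G′ = φ′/φ + φ`.
NOT claimed: `PointCertLawQ`, `TopLinkLawQ`, any atomic law, `TopPinning`.  Nothing here bears on the truth of RH; RH is not proved; 33346/33347 OPEN.
-/

noncomputable section

namespace RhW08.Lens1ArcSign

open Complex Set Metric Filter Topology
open scoped Real ComplexConjugate
open Literature.Topology.PlaneTopology Literature.Analysis.Complex
open Summit.RiemannHypothesis.RiemannHypothesis.Theorems.Splittings.JensenWindow
open RhIdea6.G17.W07C7 RhIdea6.G17.W07C7.Rev6 RhIdea6.G18.W07C8.Law421BirthS RhIdea6.G19.W07C11.Seam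
open RhIdea6.G20.W07C12.Frac RhIdea6.G20.W07C12.StColP RhW07.C12.FieldSplit RhIdea6.G21.W07C13.TentMax
open RhW07.C14.TwoSided RhW07.C14.Classes RhW07.C14.Lineage RhW07.C14.Booking
open RhW07.C13.Heredity RhIdea6.G22.W07C15pre.Injection RhW07.E3.Cell RhW07.E3.Lit
open RhW08.Round1 RhW08.StSwap RhW08.Round2 RhW08.QuadW RhW08.SealSwapQ RhW08.SealSwap RhW08.SuccB RhW08.SuccSplit
open RhW08.SuccTheft RhW08.Column RhW08.Hurwitz RhW08.ClusterQ RhW08.ClusterQM RhW08.NewtonDoor RhW08.NewtonDoorGenusOne RhW08.PurseP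
open RhW08.Lens1SignCut RhW08.Lens1Coverage RhW08.IsolatedTilt RhW08.Lens1Pinning RhW08.Lens1PinningIso


/-! ## §1 children from Jensen containment one level up -/

/-- ★ CHILD PRODUCER: an upper point `z` with `Im(f^{(j+2)}(z)/f^{(j+1)}(z)) ≥ 0` lies in the closed Jensen disc of a non-real zero `w` of `f^{(j+1)}`
(part Qʼs containment applied to `f^{(j+1)}`; needs `f^{(j+1)}` to have at least one zero). -/
theorem exists_childDisc_of_im_nonneg {f : ℂ → ℂ} (hf : RealEntireLt2 f) (j : ℕ) {z : ℂ} (hz : 0 < z.im)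
    (hex : ∃ r, iteratedDeriv (j + 1) f r = 0) (hpos : 0 ≤ (iteratedDeriv (j + 2) f z / iteratedDeriv (j + 1) f z).im) :
    ∃ w : ℂ, iteratedDeriv (j + 1) f w = 0 ∧ w.im ≠ 0 ∧ ‖z - (w.re : ℂ)‖ ≤ |w.im| :=
  exists_jensenDisc_of_im_nonneg hf (j + 1) hz hex hpos

/-- ★ JENSENʼS THEOREM (order `< 2`, by containment): a non-real upper zero `w` of `f^{(j+1)}` lies in the closed Jensen disc of a non-real zero of `f^{(j)}`
(given that `f^{(j)}` has a zero at all). -/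
theorem child_mem_jensenDisc {f : ℂ → ℂ} (hf : RealEntireLt2 f) (j : ℕ) {w : ℂ} (hw : iteratedDeriv (j + 1) f w = 0) (hw0 : 0 < w.im)
    (hex : ∃ r, iteratedDeriv j f r = 0) :
    ∃ r : ℂ, iteratedDeriv j f r = 0 ∧ r.im ≠ 0 ∧ ‖w - (r.re : ℂ)‖ ≤ |r.im| :=
  exists_jensenDisc_of_im_nonneg hf j hw0 hex (by rw [hw, zero_div, Complex.zero_im])

/-! ## §2 capture geometry -/

/-- A disc NESTED in aʼs closed Jensen disc (`|Re r − Re a| + |Im r| ≤ Im a`) only holds points of aʼs closed disc. -/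
theorem nestedStep_of_mem_nestedDisc {a r w : ℂ} (hn : |r.re - a.re| + |r.im| ≤ a.im) (hw : ‖w - (r.re : ℂ)‖ ≤ |r.im|) : NestedStep a w := by
  have h1 : ‖w - (a.re : ℂ)‖ ≤ ‖w - (r.re : ℂ)‖ + ‖(r.re : ℂ) - (a.re : ℂ)‖ := norm_sub_le_norm_sub_add_norm_sub _ _ _
  have h2 : ‖(r.re : ℂ) - (a.re : ℂ)‖ = |r.re - a.re| := by
    rw [← Complex.ofReal_sub, Complex.norm_real, Real.norm_eq_abs]
  have h3 : ‖w - (a.re : ℂ)‖ ≤ |a.im| :=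
    calc ‖w - (a.re : ℂ)‖ ≤ ‖w - (r.re : ℂ)‖ + ‖(r.re : ℂ) - (a.re : ℂ)‖ := h1
      _ ≤ |r.im| + |r.re - a.re| := by rw [h2]; linarith [hw]
      _ ≤ a.im := by linarith
      _ ≤ |a.im| := le_abs_self _
  exact (norm_sub_re_le_iff w a).1 h3

/-- The √2-LEMMA: a zero `r` INVISIBLE from `z` (`2·Im r² < (Re z − Re r)² + 2·Im z²`) cannot hold in its closed disc a point `w` whose closed Jensen disc
contains `z`. -/
theorem not_capture_of_invisible {z r w : ℂ} (hinv : 2 * r.im ^ 2 < (z.re - r.re) ^ 2 + 2 * z.im ^ 2)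
    (hzw : ‖z - (w.re : ℂ)‖ ≤ |w.im|) (hwr : ‖w - (r.re : ℂ)‖ ≤ |r.im|) : False := by
  have h1 := (norm_sub_re_le_iff z w).1 hzw
  have h2 := (norm_sub_re_le_iff w r).1 hwr
  nlinarith [sq_nonneg (z.re - 2 * w.re + r.re)]

/-- CERT-CLEAR point for `a`: every non-real zero of `f^{(j)}` is `a`, `ā`, nested in aʼs closed disc, or invisible from `z`. -/
def CertClear (f : ℂ → ℂ) (j : ℕ) (a z : ℂ) : Prop :=
  ∀ r : ℂ, iteratedDeriv j f r = 0 → r.im ≠ 0 →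
    r = a ∨ r = conj a ∨ |r.re - a.re| + |r.im| ≤ a.im ∨ 2 * r.im ^ 2 < (z.re - r.re) ^ 2 + 2 * z.im ^ 2

/-- At a cert-clear point, whichever zero captures the child, the child is in aʼs closed disc. -/
theorem nestedStep_of_certClear {f : ℂ → ℂ} {j : ℕ} {a z w r : ℂ} (hc : CertClear f j a z) (hzw : ‖z - (w.re : ℂ)‖ ≤ |w.im|)
    (hr : iteratedDeriv j f r = 0) (hri : r.im ≠ 0) (hwr : ‖w - (r.re : ℂ)‖ ≤ |r.im|) : NestedStep a w := by
  rcases hc r hr hri with h | h | h | h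
  · subst h; exact (norm_sub_re_le_iff w r).1 hwr
  · subst h
    have h' := (norm_sub_re_le_iff w (conj a)).1 hwr
    rw [Complex.conj_re, Complex.conj_im, neg_sq] at h'
    exact h'
  · exact nestedStep_of_mem_nestedDisc h hwr
  · exact (not_capture_of_invisible h hzw hwr).elim

/-! ## §3 the point-certificate theorem and the typed law -/

/-- ★★ POINT CERTIFICATE ⇒ NESTED CHILD: `f` real entire of order `< 2`, `a` a zero of `f^{(j)}`, `f^{(j+1)}` with at least one zero, and an upper point `z`
with `Im(f^{(j+2)}(z)/f^{(j+1)}(z)) ≥ 0` that is cert-clear for `a` ⇒ a NON-REAL child in aʼs CLOSED Jensen disc (first disjunct of `TopPinning`). -/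
theorem exists_nestedChild_of_pointCert {f : ℂ → ℂ} (hf : RealEntireLt2 f) (j : ℕ) {a z : ℂ} (ha : iteratedDeriv j f a = 0) (hz : 0 < z.im)
    (hex : ∃ r, iteratedDeriv (j + 1) f r = 0) (hpos : 0 ≤ (iteratedDeriv (j + 2) f z / iteratedDeriv (j + 1) f z).im)
    (hc : CertClear f j a z) : ∃ w : ℂ, iteratedDeriv (j + 1) f w = 0 ∧ w.im ≠ 0 ∧ NestedStep a w := by
  obtain ⟨w₀, hw₀, hw₀i, hzw₀⟩ := exists_childDisc_of_im_nonneg hf j hz hex hpos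
  have hG1 : RealEntireLt2 (iteratedDeriv (j + 1) f) := RhW08.WindowLoss.realEntireLt2_iteratedDeriv hf (j + 1)
  -- normalise to an upper child `w` with the same Jensen disc
  obtain ⟨w, hw, hwpos, hzw, hre⟩ : ∃ w : ℂ, iteratedDeriv (j + 1) f w = 0 ∧ 0 < w.im ∧ ‖z - (w.re : ℂ)‖ ≤ |w.im| ∧
      (w.re = w₀.re ∧ w.im ^ 2 = w₀.im ^ 2) := by
    rcases lt_or_gt_of_ne hw₀i with hneg | hposw
    · refine ⟨conj w₀, ?_, ?_, ?_, ?_⟩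
      · rw [apply_conj_eq_conj hG1.diff hG1.real, hw₀, map_zero]
      · rw [Complex.conj_im]; linarith
      · rw [Complex.conj_re, Complex.conj_im, abs_neg]; exact hzw₀
      · rw [Complex.conj_re, Complex.conj_im, neg_sq]; exact ⟨rfl, rfl⟩
    · exact ⟨w₀, hw₀, hposw, hzw₀, rfl, rfl⟩
  obtain ⟨r, hr, hri, hwr⟩ := child_mem_jensenDisc hf j hw hwpos ⟨a, ha⟩
  exact ⟨w, hw, hwpos.ne', nestedStep_of_certClear hc hzw hr hri hwr⟩

/-- ★ THE POINT-CERTIFICATE LAW (OPEN, typed; binders of `TopLinkLawQ`): at a SIMPLE crossing top there is an upper point `z` with `Im(f^{(j+2)}/f^{(j+1)})(z) ≥ 0`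
that is cert-clear for `a` (and `f^{(j+1)}` has a zero).  PATH-FREE; expected to hold on the «high-mate» sub-class only (toy: ≈ 2/3 of atomic frames). -/
def PointCertLawQ : Prop :=
  ∀ (η : ℝ) (f : ℂ → ℂ) (x₀ s hmax R Hs : ℝ) (B : ℕ), EngineHyps5 2 η f x₀ s hmax R Hs B → ∀ (j : ℕ) (a : ℂ),
    iteratedDeriv j f a = 0 → 0 < a.im → NoTallerToucher f j a → ¬ JensenIsolated f j a → iteratedDeriv (j + 1) f a ≠ 0 →
    (∃ r, iteratedDeriv (j + 1) f r = 0) ∧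
      ∃ z : ℂ, 0 < z.im ∧ 0 ≤ (iteratedDeriv (j + 2) f z / iteratedDeriv (j + 1) f z).im ∧ CertClear f j a z

/-- ★★ `PointCertLawQ ⟹ TopPinningCrossing` (the treeʼs crossing residual of the law; a multiple `a` is its own child). -/
theorem topPinningCrossing_of_pointCertLaw (hL : PointCertLawQ) : TopPinningCrossing := by
  intro η f x₀ s hmax R Hs B hE j a ha hapos hN hJ
  by_cases hda : iteratedDeriv (j + 1) f a = 0
  · exact Or.inl ⟨a, hda, hapos.ne', by show (a.re - a.re) ^ 2 + a.im ^ 2 ≤ a.im ^ 2; simp⟩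
  obtain ⟨hex, z, hz, hpos, hc⟩ := hL η f x₀ s hmax R Hs B hE j a ha hapos hN hJ hda
  exact Or.inl (exists_nestedChild_of_pointCert (realEntireLt2_of_hyps hE) j ha hz hex hpos hc)

/-- ★★★ … hence `PointCertLawQ ⟹ TopPinning` outright (the Jensen-isolated branch is the treeʼs `topPinning_of_crossing`). -/
theorem topPinning_of_pointCertLaw (hL : PointCertLawQ) : TopPinning :=
  topPinning_of_crossing (topPinningCrossing_of_pointCertLaw hL)

/-- The same producer, row-level, with the frame binders (what an instrument certifies for ONE frame). -/
theorem pinning_of_pointCert {η : ℝ} {f : ℂ → ℂ} {x₀ s hmax R Hs : ℝ} {B : ℕ} (hE : EngineHyps5 2 η f x₀ s hmax R Hs B) {j : ℕ} {a z : ℂ}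
    (ha : iteratedDeriv j f a = 0) (hz : 0 < z.im) (hex : ∃ r, iteratedDeriv (j + 1) f r = 0)
    (hpos : 0 ≤ (iteratedDeriv (j + 2) f z / iteratedDeriv (j + 1) f z).im) (hc : CertClear f j a z) :
    (∃ w : ℂ, iteratedDeriv (j + 1) f w = 0 ∧ w.im ≠ 0 ∧ NestedStep a w) ∨ (∃ x : ℝ, |x - a.re| ≤ a.im ∧ NLEventOf f j x) :=
  Or.inl (exists_nestedChild_of_pointCert (realEntireLt2_of_hyps hE) j ha hz hex hpos hc)

/-! ## §4 the census currency: the tilt-free margin -/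

/-- ★ MÖBIUS-CIRCLE BOUND: for `Im B > 0` and every real `g`, `Im(A/(B + g)) ≥ −(Re A + ‖A‖)/(2·Im B)` (the values `A/(B + g)`, `g ∈ ℝ`, run over a circle
through `0`; this is its lowest ordinate). -/
theorem im_div_add_real_ge (A B : ℂ) (hB : 0 < B.im) (g : ℝ) : -((A.re + ‖A‖) / (2 * B.im)) ≤ (A / (B + g)).im := by
  have hu : (B + g).im = B.im := by simp
  have hne : B + (g : ℂ) ≠ 0 := by
    intro h0; have := congrArg Complex.im h0; rw [hu, Complex.zero_im] at this; exact hB.ne' this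
  have hns : 0 < Complex.normSq (B + g) := Complex.normSq_pos.2 hne
  set u : ℝ := (B + (g : ℂ)).re with hudef
  have hn : Complex.normSq (B + g) = u ^ 2 + B.im ^ 2 := by rw [Complex.normSq_apply, ← hudef, hu]; ring
  have him : (A / (B + g)).im = (A.im * u - A.re * B.im) / (u ^ 2 + B.im ^ 2) := by
    rw [Complex.div_im, ← hudef, hu, hn]; ring
  have hA : ‖A‖ ^ 2 = A.re ^ 2 + A.im ^ 2 := by rw [← Complex.normSq_eq_norm_sq, Complex.normSq_apply]; ring
  have hAre : -‖A‖ ≤ A.re := by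
    have := Complex.abs_re_le_norm A; rw [abs_le] at this; exact this.1
  have hden : 0 < u ^ 2 + B.im ^ 2 := by positivity
  rw [him, neg_le, ← neg_div, div_le_div_iff₀ hden (by positivity)]
  -- (A.re B.im − A.im u)·(2 B.im) ≤ (A.re + ‖A‖)(u² + B.im²): a perfect square after multiplying by (A.re + ‖A‖) ≥ 0
  have key : (A.re + ‖A‖) * ((A.re + ‖A‖) * (u ^ 2 + B.im ^ 2) - (A.re * B.im - A.im * u) * (2 * B.im)) =
      ((A.re + ‖A‖) * u + A.im * B.im) ^ 2 := by nlinarith [hA]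
  by_cases h0 : A.re + ‖A‖ = 0
  · have hAim : A.im = 0 := by nlinarith [hA, norm_nonneg A]
    rw [h0, hAim]; nlinarith [norm_nonneg A]
  · have hpos' : 0 < A.re + ‖A‖ := lt_of_le_of_ne (by linarith) (Ne.symm h0)
    have hsq : 0 ≤ ((A.re + ‖A‖) * u + A.im * B.im) ^ 2 := sq_nonneg _
    rw [← key] at hsq
    nlinarith [(mul_nonneg_iff_of_pos_left hpos').1 hsq]

/-- The TILT-FREE MARGIN of a point (C6ʼs model: `ψ = P′/P` at `z`, `ψ′` its derivative): `Im ψ − (Re ψ′ + ‖ψ′‖)/(2·Im ψ)`. -/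
def tiltMargin (ψ dψ : ℂ) : ℝ := ψ.im - (dψ.re + ‖dψ‖) / (2 * ψ.im)

/-- ★ For EVERY real tilt `g`: `Im(ψ′/(ψ + g) + ψ + g) ≥ tiltMargin ψ ψ′` (when `Im ψ > 0`); so `tiltMargin ≥ 0` certifies `Im φ₂ ≥ 0` at that point for all
tilts at once. -/
theorem im_phi2_ge_tiltMargin (ψ dψ : ℂ) (hψ : 0 < ψ.im) (g : ℝ) : tiltMargin ψ dψ ≤ (dψ / (ψ + g) + ψ + g).im := by
  have h := im_div_add_real_ge dψ ψ hψ g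
  unfold tiltMargin
  simp only [Complex.add_im, Complex.ofReal_im, add_zero]
  linarith

/-- Bookkeeping identity behind §4: `G″/G′ = φ′/φ + φ` for `φ = G′/G`, wherever `G, G′ ≠ 0`. -/
theorem deriv2_div_eq_phi2 {G : ℂ → ℂ} (hG : Differentiable ℂ G) {z : ℂ} (hz : G z ≠ 0) (hz' : deriv G z ≠ 0) :
    deriv (deriv G) z / deriv G z = deriv (fun w => deriv G w / G w) z / (deriv G z / G z) + deriv G z / G z := by
  rw [deriv_logDeriv hG hz]
  field_simp
  ring

end RhW08.Lens1ArcSign
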